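import Summits.CriticalPhenomena.SAWScalingLimit.Theorems.SAWLoopFugacityFlowSimpleSubseqLimitsSplit
import HarnessLib

/-!
# `SlitSplitDischarge` (stmt-CriticalPhenomena-18279), route SAWLoopFugacityFlow — PROVED

The top-level link that puts the gen-1 split of the crux `SimpleSubseqLimits` (stmt-4982) into the cone of the
deciding theorem: `SlitSplitGlue → SeqSlitAvoidance → AvoidanceLimit → SimpleSubseqLimits`. Inside this route the
shape child `LimitAvoidanceValues` is free given the A-side, so the crux child `SeqSlitAvoidance` (stmt-18169) and
the A-side `AvoidanceLimit` (stmt-10649) already give the parent — this is the landed by-name assembly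
`SlitSplit.SimpleSubseqLimits_of` (p167870; = `SlitRestriction.Line.line_slitContinuousRestriction`, p154999);
the split-glue hypothesis is idle (and itself proved: `SlitSplit.slitSplitGlue_proof`). Prepared by the
crux-strategist re-exam seat `cstrat-stmt-CriticalPhenomena-4982-r1` (2026-08-17). No sorry; standard axioms.
-/

namespace Summit.CriticalPhenomena.SAWScalingLimit.Theorems.SimpleSubseqLimits.SlitSplit

open Summit.CriticalPhenomena.SAWScalingLimit.Theses.SAWLoopFugacityFlow
  (SimpleSubseqLimits AvoidanceLimit SeqSlitAvoidance SlitSplitGlue SlitSplitDischarge)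

/-- **`SlitSplitDischarge` (stmt-CriticalPhenomena-18279), proved**: the crux child and the A-side give the parent
crux (landed `SlitSplit.SimpleSubseqLimits_of`); the split-glue hypothesis is not needed. [folklore] -/
theorem slitSplitDischarge_proof : SlitSplitDischarge :=
  show SlitSplitGlue → SeqSlitAvoidance → AvoidanceLimit → SimpleSubseqLimits from
    fun _ => SimpleSubseqLimits_of

end Summit.CriticalPhenomena.SAWScalingLimit.Theorems.SimpleSubseqLimits.SlitSplit
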